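import Literature.MathematicalPhysics.QuantumFieldTheory.Balaban1983to89.B8Thm2TorusCoverOfProp6DeltaAFour
import Literature.MathematicalPhysics.QuantumFieldTheory.Balaban1983to89.B9Ineq347BondReadingYInv
import Literature.MathematicalPhysics.QuantumFieldTheory.Balaban1983to89.B9Thm37GpTorusRegular
import Literature.MathematicalPhysics.QuantumFieldTheory.Balaban1983to89.B9RowSum261DefiniteFaces
import Literature.MathematicalPhysics.QuantumFieldTheory.Balaban1983to89.B9GeoInputsMultiRateKLevelV1

/-!
# `Balaban1983to89.B8Thm2TorusCoverOfEBlock` — sub-row G-B8-T2S, file G9: [Balaban1985RegularSpaces] THEOREM 2 AT THE COVER TORUS OF EVERY MEMBER `(F, n, K)`,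
# THE (Δa) FAMILY ONE CURRENCY DOWN — displayed per shape-member as `IsUnit Δ_a` + the (3.42) BLOCK `EBlock(G_a)` of [Balaban1985BackgroundPropagators] Thm 3.3's
# class reading (the conclusion currency of M5.7's `B9Thm310DeltaAIsUnitOfExpansion.eBlock_kernelFamilyBInv_GAY_of_coverCubes''`), the three weighted members
# DERIVED by (3.47) «consequences of the local ones (3.42) and Lemma 2.1», and [Balaban1984PropagatorsII] Lemma 2.1 DISCHARGED at big blocks `M = L^{a′+1}`

statement-level skeleton of published theorems with citation tags; proofs where landed; nothing here is a claim about the Yang–Mills mass gap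

T. Bałaban, *Spaces of regular gauge field configurations on a lattice and gauge fixing conditions*, Commun. Math. Phys. **99** (1985) 75–102
[`Balaban1985RegularSpaces`, "[B8]"]: Thm 2 p. 83, (1.29) p. 81, (1.33)–(1.39) pp. 82–83, p. 77 («Ω_j = T_η for j = 0,1,…,l»), Prop. 3 (1.58)–(1.60) pp. 86–87.
T. Bałaban, *Propagators for lattice gauge theories in a background field*, Commun. Math. Phys. **99** (1985) 389–434 [`Balaban1985BackgroundPropagators`, "[B9]"]
(PDF held: `paper:balaban1985-cmp99-background-propagators`, journal page = PDF page + 388): (3.39)–(3.42) p. 397, p. 398 remark after (3.47) «It is easy to see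
that the global inequalities (3.47) are consequences of the local ones (3.42) and Lemma 2.1 in [4]», Thm 3.3 p. 399 («the same statements hold for the operators
G(U)»), (3.69) p. 404, (3.106) p. 414, Thm 3.10 p. 416, Thm 3.11 p. 416, p. 408 l. 30–34 («In [4] we have proved all theorems under the assumption that R, M are
sufficiently large. We take these numbers as powers of L»).  [4] = T. Bałaban, *Propagators and renormalization transformations for lattice gauge theories. II*,
Commun. Math. Phys. **96** (1984) 223–250 [`Balaban1984PropagatorsII`]: (2.1)–(2.4) p. 224, (2.45) p. 231, (2.59) p. 233, Lemma 2.1 (2.60)–(2.61) p. 234.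
[`Balaban1985UV3`] (1)–(3) p. 256 (the family of tori).  Rows B8.Thm2 × B9.Thm3.3 × B4.Lem2.1 (cells only; no row head changes).

WHY.  After G8 `B8Thm2TorusCoverOfProp6DeltaAFour.hThm2Cover_of_prop6_deltaAFour` the torus Thm 2 interface of record displays ONE analytic family (Δa): at every
shape-member `i` (constant level `m′`, `i.k = m′ + 1`, `i.Mh = L^{a′}`) and admissible background `U₀`, (1) `IsUnit Δ_a` and (2)–(4) the three weighted bounds
`|G_aF|₍₋₁₎, |∇_U G_aF|₍₋₂₎, |Δ_U G_aF|₍₋₃₎ ≤ B₀|F|₍₋₃₎` at def-Y's letters.  The G-B9-LETTERS road (M5.7) produces (2)–(4) in ANOTHER currency — the (3.42) block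
`EBlock (kernelFamilyBInv i B cfg (G_a) par) B_E δ_E U₁` of the invariant-class reading, reading-generic (`….eBlock_kernelFamilyBInv_GAY_of_coverCubes''`,
`B9Cor36GCubeLocAtMemberClosed.eBlock_locLetterBY''`) — and G7 §5 `B9Ineq347BondReadingYInv.wNormBY_three_of_eBlock` converts, GIVEN a section `ιB` of the member's
carrier-block map `β` and [4] Lemma 2.1 for `toB6 (geo9K i)`.  The obstacle booked at g9's close: the catalogue's surjectivity of `β` is discarded by F10′, and
A11's `surjective_beta_of_constLev` is typed at `K = 0` tori.  THIS FILE removes it by the `K = 0` GENERALISATION (no binder change, no re-run of F10′∕G6b∕G8): A11's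
two lemmas hold VERBATIM at a general Setup torus `PV d ℓ m K` (`B9BetaRangeKLevelV1.surjective_beta_iff` and `B6GlobalChartV1.iterBlockOf_mem_domT_iff` are
already typed there), so EVERY shape-member of the binder has `β` onto and `Function.surjInv` is a section; then the four-member binder follows from the
EBlock-currency binder member by member, and [4] Lemma 2.1 at the members with `i.Mh = L^{a′}` is a theorem of the tree above a threshold on `a′`.

WHAT IS PROVED (all `theorem`s; 0 `def`, 0 `… : Prop` fact, 0 sorry; standard axioms `propext ∕ Classical.choice ∕ Quot.sound`).
* §1 `not_deep_of_constLev'`, ★ `surjective_beta_of_constLev'` (A11 §1 at `PV d ℓ m K`, nominal index a variable `k = n + 1`), ★ `surjective_beta_kIdx_of_constLev` —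
  a k-level index of constant level `n` with `i.k = n + 1` has `β` onto `𝔅`.
* §2 `twelve_le_c1`; ★★ `deltaAFour_of_eBlock` (any `d`, `M_N(ℂ)`) — the FOUR-member (Δa) binder of F10′ ∕ G6b ∕ G8 at `B₀ := B_E·c₁(d′, δ_E, 1−α)·L⁴` FROM: the
  geometric data `hgeo` of the members with `i.Mh = L^{a′}` ((2.60) at `(δ_E, α)`, (2.61) at `(δ_E, 1−α)` with exponent `d′` for `toB6 (geo9K i) Rg Hg`, size
  `4·log L ≤ αδ_E·Rg·(L·M_h)`) and the EBlock-CURRENCY BINDER — same shape clauses and admissibility, conclusion (1) `IsUnit (deltaAY i (parKnitY i) (parBY i)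
  (GpY i (parKnitY i)) (bgY i U₀))` ∧ (E) `∀ (B : B9.Backgrounds) cfg par U₁, cfg U₁ = bgY i U₀ → EBlock (kernelFamilyBInv i B cfg (GAY i (parKnitY i) (parBY i)
  (GpY i (parKnitY i))) par) B_E δ_E U₁`.  Proof: §1's section + G7 §5 at the one-point reading `cfg () := bgY i U₀`.
* §3 `B₀_pos`; ★★★★★ `thm2TorusAtSU_ofProp6_eBlock_exists` — G6b §2′ `thm2TorusAtSU_ofProp6_deltaAFour_exists` (any `d ≥ 1`, `SU(N)`, `N ≤ 25`, both halves of Thm 2 in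
  `Thm2TorusAt` currency, (3.35) dropped by Prop. 6) VERBATIM at that `B₀`, with the binder in the EBlock currency and `hgeo` displayed.
* §4 ★★★★★ `hThm2Cover_of_prop6_eBlock` — G8 `hThm2Cover_of_prop6_deltaAFour` (`d + 1 = 3`, `N = 2`, Thm 2 at the cover torus `PV 2 ℓ (F.m + k₀) K` of EVERY member
  `(F, n, K)` + `P ∣ P′` + `L^{K−n} ∣ P`, no located volume threshold) VERBATIM at that `B₀`, binder in the EBlock currency, `hgeo` displayed.
* §5 ★ `exists_geo_threshold` (any `d`, any band) — `∃ d′ A₀, 8 ≤ L^{A₀} ∧ ∀ a′ ≥ A₀`, every member with `i.Mh = L^{a′}` has `hgeo` at `Rg := 1`: (2.60) threshold-free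
  from the level gap (`B9GeoLemma21KLevelV1.levelGap_geo9K_one`, `B9RowSum261DefiniteFaces.ineq260_toB6_of_levelGap`), (2.61) at the door exponent
  `d′ := exp261 geo9K δ_E (1−α)` above its `M`-threshold (`B9Thm37GpTorusRegular.geo_inputs_geo9K`), the size condition for `L^{a′} ≥ 4·log L ∕ (αδ_E)`
  (`B8Thm2TorusOfProp6DeltaAFour.exists_exponent_ge`); ★★★★★ `hThm2Cover_of_prop6_eBlock_exists` — §4 with `hgeo` GONE: `∃ d′ A₀, ∀ a′ ≥ A₀, ∀ a_T` in the windows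
  with F7's numeric condition at `B₀ := B_E·c₁(d′, δ_E, 1−α)·L⁴` (`B_E > 0` bound AFTER `a′`), §4's conclusion.

INTERFACE OF RECORD AFTER THIS FILE (what the 19200 consumer `thm2TorusAt_of_dvd` ∘ `thm2SetupSUAt_of_thm2TorusAt` reads): §5 `hThm2Cover_of_prop6_eBlock_exists` —
[B8] Thm 2 (both halves, `SU(2)`, `Reg := ⊤`, (3.35) dropped) at the cover torus of every `(F, n, K)`, MODULO, at every shape-member `i` of the cover torus
(`1 ≤ m′ ≤ K − n`, `i.k = m′ + 1`, `i.Mh = L^{a′}`, `a′ ≥ A₀` the consumer's) and every `U(2)`-valued periodic `U₀ ∈ 𝔄_{m′}(T_η, α₀)`, `α₀ ≤ a_T`: (1) `IsUnit Δ_a(bgY i U₀)`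
= the conclusion of `B9Thm310DeltaAIsUnitOfExpansion.isUnit_deltaAY_of_coverCubes` at `parS := parKnitY i, parB := parBY i, Gp := GpY i (parKnitY i), cfg U₁ := bgY i U₀`,
and (E) `EBlock (kernelFamilyBInv i B cfg (G_a) par) B_E δ_E U₁` for every reading = the conclusion of `….eBlock_kernelFamilyBInv_GAY_of_coverCubes''` there (its
constant is member-uniform at fixed `a′`; `δ_E`, `α` are bound BEFORE `d′, A₀`, `B_E` AFTER `a′`).  Both come from the cube-letter families `hinvC`, `hE`, `hrest`, `hV′` (+ `hU∕hT`,
`hW`, (2.61)∕(2.63), the two smallness conditions) of the G-B9-LETTERS road (module M5.1b-G: DEFECT-R ∕ FAMFOUR ∕ ZETA-2, p33 ∕ p38 lineages) — NOT this file's.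

HONEST SCOPE ∕ NOT CLAIMED.  Composition BY NAME (G8, G6b §2′, G7 §5, A11 §1's argument, r06∕p21∕n06 geometry lemmas) plus threshold bookkeeping; NO estimate of
[B8] ∕ [B9] ∕ [4] is proved here; (1) and (E) are displayed, inhabited by nothing in this file; the located design (`B₀` read through `c₁(d′, δ_E, 1−α)·L⁴`, the door
exponent `d′`, `Rg := 1`) is the tree's, print's constants enter as O(1); `SU(2)`, `d + 1 = 3` in §4–§5 (§1–§3, `exists_geo_threshold` at any `d`); sup-entries only
(`β₀ = 0`); count-neutral; no summit ∕ sub-problem statement is proved; NOT a node discharge; `stub_PV3A` NOT discharged; nothing continuum ∕ ℝ⁴ ∕ OS ∕ mass-gap ∕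
Clay — the Yang–Mills mass gap is NOT proved by any of this.  No `sorry`, no `axiom`, no `def`, no `instance`, no `notation`.  NEW file; nothing landed is modified.
RELATED, NOT DUPLICATED (searched 2026-08-28, `lean search 'surjective_beta_of_constLev|not_deep_of_constLev|deltaAFour_of_eBlock|TorusCoverOfEBlock' --decl`): A11's
two `K = 0` lemmas (kept; these are the general-torus twins), G7 §5 (used), G8 (used).  Cell `lit-balaban`, seat `lit-balaban-t2s-1` gen 10, 2026-08-28;
`--supports stmt-QuantumFields-19200`.
-/

noncomputable section

open scoped BigOperators

namespace Literature.MathematicalPhysics.QuantumFieldTheory.Balaban1983to89.B8Thm2TorusCoverOfEBlock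

open Node00 B6KLevelCensusIndexV1
open B7Prop1Explicit renaming Site → LSite
open B7Prop2Explicit (unitaryUnits C0 c2')
open B6MultiLevelBoxOperator (N0)
open B6MultiLevelTorusOperator (TDomains)
open B6GlobalChartV1 (PV toBox domT iterBlockOf_mem_domT_iff)
open B6Ineq2142KLevelV1 (β)
open B9BetaRangeKLevelV1 (surjective_beta_iff)
open B6RandomWalk (Ineq260 Ineq261)
open B9Thm34Ext (toB6)
open B9FromB6 (EBlock)
open B9CubeLettersInvReadings (kernelFamilyBInv)
open B9GeoNormsKLevelV1 (geo9K)
open B9GeoInputsMultiRateKLevelV1 (geo9K_L_eq)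
open B9Ineq347BondReadingYInv (wNormBY_three_of_eBlock)
open B8Ineq132 (InAk)
open B8Thm2TorusLettersPerOfKnit (bgY)
open B9B8AveragingJunction (parKnitY)
open B9Eq316AveragingTransposeZd (betaTau alphaQ)
open B7Prop2SpecialUnitary (specialUnitaryUnits)
open B8Thm2TorusAt (Thm2TorusAt)
open T4TermwiseTorus (IsPeriodic)
open scoped Matrix Matrix.Norms.L2Operator

variable {d ℓ : ℕ} {hd : 1 ≤ d + 1} {hL : Odd (ℓ + 1) ∧ 1 < ℓ + 1} {b₀ b₁ : ℝ}

/-! ## §1 A constant-level member of ANY Setup torus `PV d ℓ m K` with one empty top level has its carrier-block map `β` onto `𝔅` -/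

section Section

variable {m K Mh R n : ℕ} {P' : Fin (d + 1) → ℕ}

/-- **WITH AN EMPTY TOP LEVEL NOTHING IS DEEP** — A11's `B8Thm2TorusMemberCatalogue.not_deep_of_constLev` at a GENERAL Setup torus `PV d ℓ m K` (there: `K = 0`):
for a domain sequence of constant level `n` and nominal index `n + 1` (`Ω_{n+1} = ∅`), no block of level `n` is deep. Same proof.
[cite: Balaban1984PropagatorsII, (2.3)–(2.4) p.224, dictionary (charts)] -/
theorem not_deep_of_constLev' (hN : ∀ μ, N0 ℓ Mh (n + 1) P' μ = (PV d ℓ m K hd hL).sitesPerDir 0) (D : TDomains d ℓ Mh (n + 1) P' R)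
    (hk : n + 1 ≤ m + K) (hD : ∀ x, D.lev x = n) {j : ℕ} (hj : j = n) (y : Site (PV d ℓ m K hd hL) j) :
    ¬ (domT hN D hk).Deep j y := by
  subst hj
  intro hdeep
  have hmem := hdeep
  unfold B6SectADomainsV1.Domains.Deep at hmem
  -- a fine site whose `(n+1)`-block is the `(n+1)`-block of `y`
  have hx' := Node00.iterBlockOf_embIter (P := PV d ℓ m K hd hL) _ (by exact hk) (blockOf y)
  rw [← hx'] at hmem
  have h := (iterBlockOf_mem_domT_iff hN D hk (by omega) le_rfl _).1 hmem
  rw [hD] at h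
  omega

/-- ★ **ONE EMPTY TOP LEVEL ⇒ `β` IS ONTO `𝔅`, AT A GENERAL SETUP TORUS** — A11's `surjective_beta_of_constLev` at `PV d ℓ m K` (the nominal index `k` a variable with
`k = n + 1`, so that it applies to the fields of a `KIdx`). [cite: Balaban1984PropagatorsII, (2.3) p.224, (2.45) p.231] -/
theorem surjective_beta_of_constLev' {k : ℕ} (hN : ∀ μ, N0 ℓ Mh k P' μ = (PV d ℓ m K hd hL).sitesPerDir 0) (D : TDomains d ℓ Mh k P' R)
    (hk : k ≤ m + K) (hkn : k = n + 1) (hD : ∀ x, D.lev x = n) : Function.Surjective (β hN D hk) := by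
  subst hkn
  exact (surjective_beta_iff hN D hk (by omega)).2 fun x0 => Or.inl ⟨0, not_deep_of_constLev' hN D hk hD (hD _) _⟩

/-- ★ **EVERY SHAPE-MEMBER OF THE [B8] THM 2 TORUS BINDER HAS A SECTION OF ITS CARRIER-BLOCK MAP**: a k-level index `i` of constant level `n` with nominal index
`i.k = n + 1` has `β` onto `𝔅` (so `Function.surjInv` is a section `ιB` with `β ∘ ιB = id`, the datum of the class-reading theorems `B9Ineq347BondReadingYInv` §4–§5 and
of `B9Thm310DeltaAIsUnitOfExpansion` §4). [cite: Balaban1984PropagatorsII, (2.3) p.224, (2.45) p.231; Balaban1985BackgroundPropagators, (3.42) p.397 («y′ ∈ Λ_{j′}»)] -/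
theorem surjective_beta_kIdx_of_constLev (i : KIdx d ℓ hd hL b₀ b₁) (hkn : i.k = n + 1) (hD : ∀ x, i.D.lev x = n) :
    Function.Surjective (β i.hN i.D i.hk) :=
  surjective_beta_of_constLev' i.hN i.D i.hk hkn hD

end Section

/-! ## §2 ★★ The FOUR Δ_a-side members of F10′∕G6b∕G8's binder from `IsUnit Δ_a` + the (3.42) block `EBlock(G_a)` of M5.7's class reading and [4] Lemma 2.1 -/

section Binder

variable {N : ℕ}
variable [instF : ∀ i : KIdx d ℓ hd hL 1 1, Fintype (geo9K i).Site]

/-- `c₁(d′, δ, α′) ≥ 12` for a positive rate product (`c₀ ≥ 1`). [cite: Balaban1984PropagatorsII, Lemma 2.1 p.234 («c₁(α) = 12c₀ᵈ(½α)»), p.233 (c₀)] -/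
theorem twelve_le_c1 (d' : ℕ) {δ α' : ℝ} (h : 0 < α' * δ) : 12 ≤ B6.c1 d' δ α' := by
  have h0 : 1 ≤ B6.c0 δ (α' / 2) := B6Lemma21Arith.one_le_c0 (by nlinarith)
  show (12 : ℝ) ≤ 12 * B6.c0 δ (α' / 2) ^ d'
  nlinarith [one_le_pow₀ (M₀ := ℝ) h0 (n := d')]

/-- ★★ **THE FOUR-MEMBER (Δa) BINDER FROM THE EBlock-CURRENCY BINDER.**  Fix the big-block exponent `a′`, a truncation `K′`, a torus `PV d ℓ m K`, `η`, `a_T`; an exponent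
`d′`, transport data `Rr, Hp`, rates `δ_E, α` and a block constant `B_E ≥ 0`.  SUPPOSE (geometry, displayed) every member `i` of the band-`(1,1)` family with
`i.Mh = L^{a′}` satisfies [4] (2.60) at `(δ_E, α)` and (2.61) at `(δ_E, 1 − α)` with exponent `d′` for `toB6 (geo9K i) Rr Hp`, and the size condition
`4·log L ≤ α·δ_E·Rr·(L·M_h)`; and SUPPOSE (analysis, displayed — the EBlock-currency binder) that at every shape-member `i` (constant level `1 ≤ m′ ≤ K′`,
`i.k = m′ + 1`, `i.Mh = L^{a′}`, `c_f = L^{m′+1}`, weights of record, period of `PV d ℓ m K`) and every `U(N)`-valued periodic `U₀ ∈ 𝔄_{m′}(T_η, α₀)`, `α₀ ≤ a_T`: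
(1) `Δ_a(U)` is invertible at def-Y's letters `parKnitY i, parBY i, GpY i (parKnitY i)`, `U = bgY i U₀`, and (E) for EVERY class reading `(B, cfg, par, U₁)` with
`cfg U₁ = bgY i U₀` the (3.42) block `EBlock (kernelFamilyBInv i B cfg (G_a) par) B_E δ_E U₁` holds.  THEN the FOUR-member binder of
`B9B8KnitTorusSocketCataloguedFour` ∕ `B8Thm2TorusOfProp6DeltaAFour` ∕ `B8Thm2TorusCoverOfProp6DeltaAFour` holds at `B₀ := B_E·c₁(d′, δ_E, 1−α)·L⁴`: (1) and the three
weighted bounds `|G_aF|₍₋₁₎, |∇_U G_aF|₍₋₂₎, |Δ_U G_aF|₍₋₃₎ ≤ B₀|F|₍₋₃₎`.  Proof: the member has a section of `β` (§1, `Function.surjInv`), and G7 §5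
`wNormBY_three_of_eBlock` at the one-point reading `cfg () := bgY i U₀`.
[cite: Balaban1985BackgroundPropagators, (3.42) p.397, (3.47) p.398 («consequences of the local ones (3.42) and Lemma 2.1»), Thm 3.3 p.399, (3.69) p.404, Thm 3.11 p.416; Balaban1984PropagatorsII, Lemma 2.1 (2.60)–(2.61) p.234, (2.3) p.224, (2.45) p.231; Balaban1985RegularSpaces, Thm 2 p.83, (1.58)–(1.60) pp.86–87] -/
theorem deltaAFour_of_eBlock {a' K' m K : ℕ} {η aT : ℝ} (d' : ℕ) {Rr : ℝ} {Hp : Prop} {δE α BE : ℝ} (hBE : 0 ≤ BE)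
    (hgeo : ∀ i : KIdx d ℓ hd hL 1 1, i.Mh = (ℓ + 1) ^ a' →
      Ineq260 (toB6 (geo9K i) Rr Hp) δE α ∧ Ineq261 d' (toB6 (geo9K i) Rr Hp) δE (1 - α) ∧
      4 * Real.log (geo9K i).L ≤ α * δE * Rr * (geo9K i).M)
    (hΔE : letI : CStarAlgebra (Matrix (Fin N) (Fin N) ℂ) := {}
      ∀ (i : KIdx d ℓ hd hL 1 1) (m' : ℕ), 1 ≤ m' → m' ≤ K' → i.k = m' + 1 → (∀ x, i.D.lev x = m') → i.Mh = (ℓ + 1) ^ a' →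
      i.cf = (((ℓ + 1 : ℕ) : ℝ)) ^ (m' + 1) →
      (∀ ι : IBondY i, i.w ι = i.cf ^ 2 * (((((ℓ + 1 : ℕ) : ℝ)) ^ (ι.1.1 : ℕ)) ^ (d + 1) * (1 / (((ℓ + 1 : ℕ) : ℝ)) ^ (ι.1.1 : ℕ)) ^ 2)) →
      (PV d ℓ i.m i.K hd hL).sitesPerDir 0 = (PV d ℓ m K hd hL).sitesPerDir 0 →
      ∀ (α₀ : ℝ) (U₀ : LSite (d + 1) → Fin (d + 1) → (Matrix (Fin N) (Fin N) ℂ)ˣ),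
      (∀ x κ, U₀ x κ ∈ B7Prop2Explicit.unitaryUnits (Matrix (Fin N) (Fin N) ℂ)) →
      IsPeriodic ((PV d ℓ m K hd hL).sitesPerDir 0) U₀ → 0 < α₀ → α₀ ≤ aT →
      InAk (ℓ + 1) m' η α₀ (fun _ => (Set.univ : Set (LSite (d + 1)))) U₀ →
        IsUnit (deltaAY i (parKnitY i) (parBY i) (GpY i (parKnitY i)) (bgY i U₀)) ∧
        ∀ (B : B9.Backgrounds) (cfg : B.Cfg → CfgY (Matrix (Fin N) (Fin N) ℂ) i) (par : BondParY (Matrix (Fin N) (Fin N) ℂ) i) (U₁ : B.Cfg),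
          cfg U₁ = bgY i U₀ →
          EBlock (kernelFamilyBInv i B cfg (GAY i (parKnitY i) (parBY i) (GpY i (parKnitY i))) par) BE δE U₁) :
    letI : CStarAlgebra (Matrix (Fin N) (Fin N) ℂ) := {}
    ∀ (i : KIdx d ℓ hd hL 1 1) (m' : ℕ), 1 ≤ m' → m' ≤ K' → i.k = m' + 1 → (∀ x, i.D.lev x = m') → i.Mh = (ℓ + 1) ^ a' →
      i.cf = (((ℓ + 1 : ℕ) : ℝ)) ^ (m' + 1) →
      (∀ ι : IBondY i, i.w ι = i.cf ^ 2 * (((((ℓ + 1 : ℕ) : ℝ)) ^ (ι.1.1 : ℕ)) ^ (d + 1) * (1 / (((ℓ + 1 : ℕ) : ℝ)) ^ (ι.1.1 : ℕ)) ^ 2)) →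
      (PV d ℓ i.m i.K hd hL).sitesPerDir 0 = (PV d ℓ m K hd hL).sitesPerDir 0 →
      ∀ (α₀ : ℝ) (U₀ : LSite (d + 1) → Fin (d + 1) → (Matrix (Fin N) (Fin N) ℂ)ˣ),
      (∀ x κ, U₀ x κ ∈ B7Prop2Explicit.unitaryUnits (Matrix (Fin N) (Fin N) ℂ)) →
      IsPeriodic ((PV d ℓ m K hd hL).sitesPerDir 0) U₀ → 0 < α₀ → α₀ ≤ aT →
      InAk (ℓ + 1) m' η α₀ (fun _ => (Set.univ : Set (LSite (d + 1)))) U₀ →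
        IsUnit (deltaAY i (parKnitY i) (parBY i) (GpY i (parKnitY i)) (bgY i U₀)) ∧
        (∀ F, wNormBY i (-1) (GAY i (parKnitY i) (parBY i) (GpY i (parKnitY i)) (bgY i U₀) F) ≤
          (BE * B6.c1 d' δE (1 - α) * (((ℓ + 1 : ℕ) : ℝ)) ^ 4) * wNormBY i (-3) F) ∧
        (∀ F ν, wNormBY i (-2) (cdB i (bgY i U₀) ν (GAY i (parKnitY i) (parBY i) (GpY i (parKnitY i)) (bgY i U₀) F)) ≤
          (BE * B6.c1 d' δE (1 - α) * (((ℓ + 1 : ℕ) : ℝ)) ^ 4) * wNormBY i (-3) F) ∧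
        (∀ F, wNormBY i (-3) (lapB i (bgY i U₀) (GAY i (parKnitY i) (parBY i) (GpY i (parKnitY i)) (bgY i U₀) F)) ≤
          (BE * B6.c1 d' δE (1 - α) * (((ℓ + 1 : ℕ) : ℝ)) ^ 4) * wNormBY i (-3) F) := by
  letI : CStarAlgebra (Matrix (Fin N) (Fin N) ℂ) := {}
  intro i m' h1 h2 hk hD hMh hcf hw hper α₀ U₀ hU₀ hperU hα₀ hα₀T hAk
  obtain ⟨hU, hE⟩ := hΔE i m' h1 h2 hk hD hMh hcf hw hper α₀ U₀ hU₀ hperU hα₀ hα₀T hAk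
  refine ⟨hU, ?_⟩
  -- the member has a section of its carrier-block map (§1)
  have hsurj : Function.Surjective (β i.hN i.D i.hk) := surjective_beta_kIdx_of_constLev i hk hD
  have hι : ∀ s : BlkY i, β i.hN i.D i.hk (Function.surjInv hsurj s) = s := fun s => Function.surjInv_eq hsurj s
  -- the one-point class reading `cfg () := bgY i U₀`
  let B : B9.Backgrounds :=
    { Cfg := Unit, one := (), mul := fun _ _ => (), Reg335 := fun _ _ _ => True, Reg336 := fun _ _ _ => True,
      Cplx337 := fun _ _ _ => True, Cplx338 := fun _ _ _ => True }
  obtain ⟨h260, h261, hsize⟩ := hgeo i hMh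
  have h3 := wNormBY_three_of_eBlock i (Function.surjInv hsurj) hι B (fun _ => bgY i U₀)
    (GAY i (parKnitY i) (parBY i) (GpY i (parKnitY i))) (parBY i) () d' hBE hsize h260 h261 (hE B _ (parBY i) () rfl)
  -- the constant: `(geo9K i).L ^ (4 : ℝ) = L⁴`
  have hL4 : (geo9K i).L ^ (4 : ℝ) = (((ℓ + 1 : ℕ) : ℝ)) ^ 4 := by
    rw [geo9K_L_eq, show (4 : ℝ) = ((4 : ℕ) : ℝ) by norm_num, Real.rpow_natCast]
    push_cast; ring
  rw [hL4] at h3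
  exact h3

end Binder

/-! ## §3 ★★★★★ [B8] Thm 2 on the torus (both halves, `SU(N)`, `Reg := ⊤`, (3.35) dropped by Prop. 6) modulo `IsUnit Δ_a` + the (3.42) block `EBlock(G_a)` -/

section Torus

variable {N : ℕ} [NeZero N]
variable [instF : ∀ i : KIdx d ℓ hd hL 1 1, Fintype (geo9K i).Site] [instD : ∀ i : KIdx d ℓ hd hL 1 1, DecidableEq (geo9K i).Site]

/-- the block constant `B₀ := B_E·c₁(d′, δ_E, 1−α)·L⁴` is positive. [cite: Balaban1984PropagatorsII, Lemma 2.1 p.234 («c₁(α) = 12c₀ᵈ(½α)»), bookkeeping] -/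
theorem B₀_pos (d' : ℕ) {δE α BE : ℝ} (hBE : 0 < BE) (hδE : 0 < δE) (hα1 : α < 1) :
    0 < BE * B6.c1 d' δE (1 - α) * (((ℓ + 1 : ℕ) : ℝ)) ^ 4 := by
  have h12 : 12 ≤ B6.c1 d' δE (1 - α) := twelve_le_c1 d' (by nlinarith)
  have hc : 0 < B6.c1 d' δE (1 - α) := lt_of_lt_of_le (by norm_num) h12
  positivity

/-- ★★★★★ **G6b §2′ ONE CURRENCY DOWN: [B8] THM 2 ON THE TORUS `PV d ℓ m K` (BOTH HALVES, `Thm2TorusAt`, `SU(N)`, `Reg := ⊤`, (3.35) DROPPED BY PROP. 6) MODULO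
`IsUnit Δ_a` AND THE (3.42) BLOCK `EBlock(G_a)` OF M5.7's CLASS READING.**  Statement = `B8Thm2TorusOfProp6DeltaAFour.thm2TorusAtSU_ofProp6_deltaAFour_exists` VERBATIM at
`B₀ := B_E·c₁(d′, δ_E, 1−α)·L⁴` except that (i) the geometric data of [4] Lemma 2.1 for the members with `i.Mh = L^{a′}` ((2.60) at `(δ_E, α)`, (2.61) at `(δ_E, 1−α)`
with exponent `d′` for `toB6 (geo9K i) Rg Hg`, size `4·log L ≤ αδ_E·Rg·(L·M_h)`) are ONE displayed top-level hypothesis `hgeo` (discharged in §5 for `d + 1 = 3`), and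
(ii) the (Δa) binder is in the EBlock currency: at every shape-member `i` and admissible background `U₀`, (1) `IsUnit Δ_a(bgY i U₀)` and (E) for EVERY class reading
`(B, cfg, par, U₁)` with `cfg U₁ = bgY i U₀`, `EBlock (kernelFamilyBInv i B cfg (GAY i (parKnitY i) (parBY i) (GpY i (parKnitY i))) par) B_E δ_E U₁` — the conclusion
currency of `B9Thm310DeltaAIsUnitOfExpansion.eBlock_kernelFamilyBInv_GAY_of_coverCubes''` (reading-generic, like `B9Cor36GCubeLocAtMemberClosed.eBlock_locLetterBY''`).
Proof: G6b §2′ ∘ §2.  HONEST SCOPE: (1), (E), `hgeo` displayed; `stub_PV3A` NOT discharged; the Yang–Mills mass gap is NOT proved.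
[cite: Balaban1985RegularSpaces, Thm 2 p.83, (1.33)–(1.39) pp.82–83, p.82, Prop. 6 p.99, p.77 («Ω_j = T_η»), p.76 («G = SU(N)»), (1.58)–(1.60) pp.86–87; Balaban1985BackgroundPropagators, p.408 l.30–34, (3.35)–(3.37) p.396, (3.42) p.397, (3.47) p.398, Thm 3.3 p.399, (3.69) p.404, (3.106) p.414, Thm 3.10 p.416, Thm 3.11 p.416; Balaban1984PropagatorsII, (2.1)–(2.4) p.224, Lemma 2.1 (2.60)–(2.61) p.234; Balaban1985Averaging, (4) p.18, Prop. 2 p.26; Balaban1985UV3, (1)–(3) p.256] -/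
theorem thm2TorusAtSU_ofProp6_eBlock_exists (hN : N ≤ 25) (hd2 : 2 ≤ d + 1) (hℓ : 4 ≤ ℓ)
    (τ : Matrix (Fin N) (Fin N) ℂ →ₗ[ℂ] ℂ) (hτ : ∀ a, τ a = Matrix.trace a) (hτt : ∀ a b, τ (a * b) = τ (b * a))
    {Cτ : ℝ} (hCτ : ∀ x y : Matrix (Fin N) (Fin N) ℂ, |(τ (star x * y)).re| ≤ Cτ * ‖x‖ * ‖y‖)
    {M : ℝ} (hM1 : 1 ≤ M) (d' : ℕ) {Rg : ℝ} {Hg : Prop} {δE α BE aT : ℝ} (hBE : 0 < BE) (hδE : 0 < δE) (hα1 : α < 1)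
    (haT : 0 < aT) (haTQ : aT ≤ alphaQ (d + 1) (ℓ + 1) / ((ℓ + 1 : ℕ) : ℝ) ^ 2)
    (haT3 : C0 (d + 1) * aT ≤ 1 / 3) (haT2 : 2 * aT ≤ c2' (d + 1) (ℓ + 1))
    (hεB : 2 * ((48 * ((d : ℝ) + 1) + 14 * d * M + (32 * ((d : ℝ) + 2) ^ 2 +
        12 * ((d : ℝ) + 1) ^ 2 * (13344 * ((d : ℝ) + 1) * ((d : ℝ) + 2) ^ 2 * ((d : ℝ) + 5) * (((ℓ + 1 : ℕ) : ℝ)) ^ (d + 4)) *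
          (Cτ * (letI : CStarAlgebra (Matrix (Fin N) (Fin N) ℂ) := {}; betaTau τ)))) * aT) * (BE * B6.c1 d' δE (1 - α) * (((ℓ + 1 : ℕ) : ℝ)) ^ 4) ≤ 1)
    {len : LSite (d + 1) → ℝ}
    {ι : Type} [Fintype ι] [DecidableEq ι] (b : Module.Basis ι ℝ (Matrix (Fin N) (Fin N) ℂ)) {M₂ : ℝ} (hM₂ : 0 ≤ M₂)
    (hrepr : ∀ (v : Matrix (Fin N) (Fin N) ℂ) (j : ι), |b.repr v j| ≤ M₂ * ‖v‖) (Rr : ℝ) (Hp : Prop) {a' : ℕ} (h8' : 8 ≤ (ℓ + 1) ^ a')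
    (hgeo : ∀ i : KIdx d ℓ hd hL 1 1, i.Mh = (ℓ + 1) ^ a' →
      Ineq260 (toB6 (geo9K i) Rg Hg) δE α ∧ Ineq261 d' (toB6 (geo9K i) Rg Hg) δE (1 - α) ∧
      4 * Real.log (geo9K i).L ≤ α * δE * Rg * (geo9K i).M) :
    letI : CStarAlgebra (Matrix (Fin N) (Fin N) ℂ) := {}
    ∃ a₀' : ℝ, 0 < a₀' ∧ ∃ k₀ : ℕ, ∃ cα : ℝ, 0 < cα ∧
    ∀ cL : ℝ, 0 < cL → cL * (((ℓ + 1 : ℕ) : ℝ)) ^ 2 < a₀' →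
      cL ≤ min (1 / 16) (min aT (min aT (1 / (2 * (2 * (BE * B6.c1 d' δE (1 - α) * (((ℓ + 1 : ℕ) : ℝ)) ^ 4)) * (14 * ((d + 1 - 1 : ℕ) : ℝ)) * M + 1)))) →
      cL ≤ cα →
    ∃ B₁ B₂ c₁ : ℝ, 0 < B₁ ∧ 0 < B₂ ∧ 0 < c₁ ∧ ∀ (m K k : ℕ) (η : ℝ), 1 ≤ k → k + k₀ ≤ m + K → 0 < η →
      (∀ (i : KIdx d ℓ hd hL 1 1) (m' : ℕ), 1 ≤ m' → m' ≤ k → i.k = m' + 1 → (∀ x, i.D.lev x = m') → i.Mh = (ℓ + 1) ^ a' →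
        i.cf = (((ℓ + 1 : ℕ) : ℝ)) ^ (m' + 1) →
        (∀ ι : IBondY i, i.w ι = i.cf ^ 2 * (((((ℓ + 1 : ℕ) : ℝ)) ^ (ι.1.1 : ℕ)) ^ (d + 1) * (1 / (((ℓ + 1 : ℕ) : ℝ)) ^ (ι.1.1 : ℕ)) ^ 2)) →
        (PV d ℓ i.m i.K hd hL).sitesPerDir 0 = (PV d ℓ m K hd hL).sitesPerDir 0 →
        ∀ (α₀ : ℝ) (U₀ : LSite (d + 1) → Fin (d + 1) → (Matrix (Fin N) (Fin N) ℂ)ˣ),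
        (∀ x κ, U₀ x κ ∈ B7Prop2Explicit.unitaryUnits (Matrix (Fin N) (Fin N) ℂ)) →
        IsPeriodic ((PV d ℓ m K hd hL).sitesPerDir 0) U₀ → 0 < α₀ → α₀ ≤ aT →
        InAk (ℓ + 1) m' η α₀ (fun _ => (Set.univ : Set (LSite (d + 1)))) U₀ →
          IsUnit (deltaAY i (parKnitY i) (parBY i) (GpY i (parKnitY i)) (bgY i U₀)) ∧
          ∀ (B : B9.Backgrounds) (cfg : B.Cfg → CfgY (Matrix (Fin N) (Fin N) ℂ) i) (par : BondParY (Matrix (Fin N) (Fin N) ℂ) i) (U₁ : B.Cfg),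
            cfg U₁ = bgY i U₀ →
            EBlock (kernelFamilyBInv i B cfg (GAY i (parKnitY i) (parBY i) (GpY i (parKnitY i))) par) BE δE U₁) →
      Thm2TorusAt (ℓ + 1) k ((((PV d ℓ m K hd hL).sitesPerDir 0 : ℕ) : ℤ)) η 0 B₁ B₂ c₁ len (specialUnitaryUnits (Fin N)) (fun _ => True) := by
  letI : CStarAlgebra (Matrix (Fin N) (Fin N) ℂ) := {}
  have hB₀ : 0 < BE * B6.c1 d' δE (1 - α) * (((ℓ + 1 : ℕ) : ℝ)) ^ 4 := B₀_pos (ℓ := ℓ) d' hBE hδE hα1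
  obtain ⟨a₀', ha₀', k₀, cα, hcα, H⟩ :=
    B8Thm2TorusOfProp6DeltaAFour.thm2TorusAtSU_ofProp6_deltaAFour_exists (hd := hd) (hL := hL) (len := len) hN hd2 hℓ τ hτ hτt hCτ hM1 hB₀
      haT haTQ haT3 haT2 hεB b hM₂ hrepr Rr Hp h8'
  refine ⟨a₀', ha₀', k₀, cα, hcα, fun cL hcL hαe hcLP hcLα => ?_⟩
  obtain ⟨B₁, B₂, c₁, hB₁, hB₂, hc₁, HT⟩ := H cL hcL hαe hcLP hcLα
  exact ⟨B₁, B₂, c₁, hB₁, hB₂, hc₁, fun m K k η hk hkK hη hΔE =>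
    HT m K k η hk hkK hη (deltaAFour_of_eBlock (instF := instF) d' hBE.le hgeo hΔE)⟩

end Torus

/-! ## §4 ★★★★★ The interface of record (G8) one currency down: Thm 2 at the COVER torus of every member `(F, n, K)`, `d + 1 = 3`, `SU(2)` -/

section Cover

open B8Thm2SetupTorus (pow_dvd_period)
open B8Thm2T3FamilyBinder (P_eq_PV)
open T3ContinuumYM3Torus (T3Family)
open T3SectALandauChart (eta eta_pos)

variable {hd₃ : 1 ≤ 2 + 1}
variable [instF : ∀ i : KIdx 2 ℓ hd₃ hL 1 1, Fintype (geo9K i).Site] [instD : ∀ i : KIdx 2 ℓ hd₃ hL 1 1, DecidableEq (geo9K i).Site]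

/-- ★★★★★ **G8 `hThm2Cover_of_prop6_deltaAFour` ONE CURRENCY DOWN: [B8] THM 2 (BOTH HALVES) AT THE COVER TORUS `PV 2 ℓ (F.m + k₀) K` OF EVERY MEMBER `(F, n, K)`,
WITH THE TWO DIVISIBILITIES THE PERIOD REDUCTION READS, MODULO `IsUnit Δ_a` + THE (3.42) BLOCK `EBlock(G_a)`** (`d + 1 = 3`, `N = 2`).  Statement = G8 VERBATIM at
`B₀ := B_E·c₁(d′, δ_E, 1−α)·L⁴` except: (i) the geometric data of the members with `i.Mh = L^{a′}` are the displayed top-level hypothesis `hgeo` ((2.60) at `(δ_E, α)`,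
(2.61) at `(δ_E, 1−α)` with exponent `d′` for `toB6 (geo9K i) Rg Hg`, size `4·log L ≤ αδ_E·Rg·(L·M_h)`; discharged in §5); (ii) the (Δa) binder, asked at the
shape-members of the COVER torus, reads: (1) `IsUnit Δ_a(bgY i U₀)` and (E) for every class reading `(B, cfg, par, U₁)` with `cfg U₁ = bgY i U₀`,
`EBlock (kernelFamilyBInv i B cfg (GAY i (parKnitY i) (parBY i) (GpY i (parKnitY i))) par) B_E δ_E U₁`.  Conclusion unchanged: `P ∣ P′ ∧ L^{K−n} ∣ P ∧
Thm2TorusAt (ℓ+1) (K − n) P′ (eta F n K) 0 B₁ B₂ c₁ len SU(2) ⊤` (19200 side: `thm2TorusAt_of_dvd`, then `thm2SetupSUAt_of_thm2TorusAt`).  Proof: G8's over §3.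
HONEST SCOPE: (1), (E), `hgeo` displayed — (1) is the conclusion of `B9Thm310DeltaAIsUnitOfExpansion.isUnit_deltaAY_of_coverCubes`, (E) that of
`….eBlock_kernelFamilyBInv_GAY_of_coverCubes''`, both from the cube-letter families `hinvC`, `hE`, `hrest`, `hV′` of the G-B9-LETTERS road (M5.1b-G), which stay THEIR
suppliers'; `stub_PV3A` NOT discharged; nothing continuum ∕ ℝ⁴ ∕ OS — the Yang–Mills mass gap is NOT proved.
[cite: Balaban1985RegularSpaces, Thm 2 p.83, (1.29) p.81, (1.33)–(1.39) pp.82–83, p.77, (1.58)–(1.60) pp.86–87; Balaban1985BackgroundPropagators, p.408 l.30–34, (3.35)–(3.37) p.396, (3.42) p.397, (3.47) p.398, Thm 3.3 p.399, (3.69) p.404, (3.106) p.414, Thm 3.10 p.416, Thm 3.11 p.416; Balaban1984PropagatorsII, Lemma 2.1 (2.60)–(2.61) p.234; Balaban1985UV3, (1)–(3) p.256] -/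
theorem hThm2Cover_of_prop6_eBlock (hℓ : 4 ≤ ℓ)
    (τ : Matrix (Fin 2) (Fin 2) ℂ →ₗ[ℂ] ℂ) (hτ : ∀ a, τ a = Matrix.trace a) (hτt : ∀ a b, τ (a * b) = τ (b * a))
    {Cτ : ℝ} (hCτ : ∀ x y : Matrix (Fin 2) (Fin 2) ℂ, |(τ (star x * y)).re| ≤ Cτ * ‖x‖ * ‖y‖)
    {M : ℝ} (hM1 : 1 ≤ M) (d' : ℕ) {Rg : ℝ} {Hg : Prop} {δE α BE aT : ℝ} (hBE : 0 < BE) (hδE : 0 < δE) (hα1 : α < 1)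
    (haT : 0 < aT) (haTQ : aT ≤ alphaQ (2 + 1) (ℓ + 1) / ((ℓ + 1 : ℕ) : ℝ) ^ 2)
    (haT3 : C0 (2 + 1) * aT ≤ 1 / 3) (haT2 : 2 * aT ≤ c2' (2 + 1) (ℓ + 1))
    (hεB : 2 * ((48 * (((2 : ℕ) : ℝ) + 1) + 14 * ((2 : ℕ) : ℝ) * M + (32 * (((2 : ℕ) : ℝ) + 2) ^ 2 +
        12 * (((2 : ℕ) : ℝ) + 1) ^ 2 * (13344 * (((2 : ℕ) : ℝ) + 1) * (((2 : ℕ) : ℝ) + 2) ^ 2 * (((2 : ℕ) : ℝ) + 5) * (((ℓ + 1 : ℕ) : ℝ)) ^ (2 + 4)) *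
          (Cτ * (letI : CStarAlgebra (Matrix (Fin 2) (Fin 2) ℂ) := {}; betaTau τ)))) * aT) * (BE * B6.c1 d' δE (1 - α) * (((ℓ + 1 : ℕ) : ℝ)) ^ 4) ≤ 1)
    {len : LSite (2 + 1) → ℝ}
    {ι : Type} [Fintype ι] [DecidableEq ι] (b : Module.Basis ι ℝ (Matrix (Fin 2) (Fin 2) ℂ)) {M₂ : ℝ} (hM₂ : 0 ≤ M₂)
    (hrepr : ∀ (v : Matrix (Fin 2) (Fin 2) ℂ) (j : ι), |b.repr v j| ≤ M₂ * ‖v‖) (Rr : ℝ) (Hp : Prop) {a' : ℕ} (h8' : 8 ≤ (ℓ + 1) ^ a')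
    (hgeo : ∀ i : KIdx 2 ℓ hd₃ hL 1 1, i.Mh = (ℓ + 1) ^ a' →
      Ineq260 (toB6 (geo9K i) Rg Hg) δE α ∧ Ineq261 d' (toB6 (geo9K i) Rg Hg) δE (1 - α) ∧
      4 * Real.log (geo9K i).L ≤ α * δE * Rg * (geo9K i).M) :
    letI : CStarAlgebra (Matrix (Fin 2) (Fin 2) ℂ) := {}
    ∃ a₀' : ℝ, 0 < a₀' ∧ ∃ k₀ : ℕ, ∃ cα : ℝ, 0 < cα ∧
    ∀ cL : ℝ, 0 < cL → cL * (((ℓ + 1 : ℕ) : ℝ)) ^ 2 < a₀' →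
      cL ≤ min (1 / 16) (min aT (min aT (1 / (2 * (2 * (BE * B6.c1 d' δE (1 - α) * (((ℓ + 1 : ℕ) : ℝ)) ^ 4)) * (14 * ((2 + 1 - 1 : ℕ) : ℝ)) * M + 1)))) →
      cL ≤ cα →
    ∃ B₁ B₂ c₁ : ℝ, 0 < B₁ ∧ 0 < B₂ ∧ 0 < c₁ ∧
    ∀ F : T3Family, F.L = ℓ + 1 → ∀ (n K : ℕ), n < K →
      (∀ (i : KIdx 2 ℓ hd₃ hL 1 1) (m' : ℕ), 1 ≤ m' → m' ≤ K - n → i.k = m' + 1 → (∀ x, i.D.lev x = m') → i.Mh = (ℓ + 1) ^ a' →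
        i.cf = (((ℓ + 1 : ℕ) : ℝ)) ^ (m' + 1) →
        (∀ ι : IBondY i, i.w ι = i.cf ^ 2 * (((((ℓ + 1 : ℕ) : ℝ)) ^ (ι.1.1 : ℕ)) ^ (2 + 1) * (1 / (((ℓ + 1 : ℕ) : ℝ)) ^ (ι.1.1 : ℕ)) ^ 2)) →
        (PV 2 ℓ i.m i.K hd₃ hL).sitesPerDir 0 = (PV 2 ℓ (F.m + k₀) K hd₃ hL).sitesPerDir 0 →
        ∀ (α₀ : ℝ) (U₀ : LSite (2 + 1) → Fin (2 + 1) → (Matrix (Fin 2) (Fin 2) ℂ)ˣ),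
        (∀ x κ, U₀ x κ ∈ B7Prop2Explicit.unitaryUnits (Matrix (Fin 2) (Fin 2) ℂ)) →
        IsPeriodic ((PV 2 ℓ (F.m + k₀) K hd₃ hL).sitesPerDir 0) U₀ → 0 < α₀ → α₀ ≤ aT →
        InAk (ℓ + 1) m' (eta F n K) α₀ (fun _ => (Set.univ : Set (LSite (2 + 1)))) U₀ →
          IsUnit (deltaAY i (parKnitY i) (parBY i) (GpY i (parKnitY i)) (bgY i U₀)) ∧
          ∀ (B : B9.Backgrounds) (cfg : B.Cfg → CfgY (Matrix (Fin 2) (Fin 2) ℂ) i) (par : BondParY (Matrix (Fin 2) (Fin 2) ℂ) i) (U₁ : B.Cfg),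
            cfg U₁ = bgY i U₀ →
            EBlock (kernelFamilyBInv i B cfg (GAY i (parKnitY i) (parBY i) (GpY i (parKnitY i))) par) BE δE U₁) →
      (((F.P K).sitesPerDir 0 : ℕ) : ℤ) ∣ (((PV 2 ℓ (F.m + k₀) K hd₃ hL).sitesPerDir 0 : ℕ) : ℤ) ∧
      (((ℓ + 1 : ℕ) : ℤ)) ^ (K - n) ∣ (((F.P K).sitesPerDir 0 : ℕ) : ℤ) ∧
      Thm2TorusAt (ℓ + 1) (K - n) ((((PV 2 ℓ (F.m + k₀) K hd₃ hL).sitesPerDir 0 : ℕ) : ℤ)) (eta F n K) 0 B₁ B₂ c₁ len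
        (specialUnitaryUnits (Fin 2)) (fun _ => True) := by
  letI : CStarAlgebra (Matrix (Fin 2) (Fin 2) ℂ) := {}
  obtain ⟨a₀', ha₀', k₀, cα, hcα, H⟩ :=
    thm2TorusAtSU_ofProp6_eBlock_exists (d := 2) (hd := hd₃) (hL := hL) (len := len) (by norm_num) (by norm_num) hℓ τ hτ hτt hCτ hM1 d' hBE hδE hα1
      haT haTQ haT3 haT2 hεB b hM₂ hrepr Rr Hp h8' hgeo
  refine ⟨a₀', ha₀', k₀, cα, hcα, fun cL hcL hαe hcLP hcLα => ?_⟩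
  obtain ⟨B₁, B₂, c₁, hB₁, hB₂, hc₁, HT⟩ := H cL hcL hαe hcLP hcLα
  refine ⟨B₁, B₂, c₁, hB₁, hB₂, hc₁, fun F hF n K hnK hΔ => ⟨?_, ?_, ?_⟩⟩
  · -- the member's period divides the cover's: `2L^{F.m+K} ∣ 2L^{F.m+k₀+K}`
    rw [P_eq_PV (hd := hd₃) (hL := hL) F hF K]
    show ((2 * (ℓ + 1) ^ (F.m + K - 0) : ℕ) : ℤ) ∣ ((2 * (ℓ + 1) ^ (F.m + k₀ + K - 0) : ℕ) : ℤ)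
    rw [Nat.sub_zero, Nat.sub_zero]
    exact_mod_cast mul_dvd_mul_left 2 (pow_dvd_pow (ℓ + 1) (show F.m + K ≤ F.m + k₀ + K by omega))
  · -- `L^{K−n}` divides the member's period
    rw [P_eq_PV (hd := hd₃) (hL := hL) F hF K]
    exact pow_dvd_period (PV 2 ℓ F.m K hd₃ hL) (j := 0) (k := K - n) (show K - n ≤ F.m + K - 0 by omega)
  · exact HT (F.m + k₀) K (K - n) (eta F n K) (by omega) (by omega) (eta_pos F n K) hΔ

/-! ## §5 ★★★★★ The geometric data discharged above a threshold on the big-block exponent `a′` -/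

/-- ★ **THE GEOMETRIC DATA OF THE k-LEVEL V1 FAMILY AT BIG BLOCKS `M_h = L^{a′}`, ABOVE ONE THRESHOLD ON `a′`** (any `d`): for rates `δ_E > 0`, `0 < α < 1`
there are an exponent `d′` (the family's door exponent `exp261 geo9K δ_E (1−α)`) and `A₀` with `L^{A₀} ≥ 8` such that every member with `i.Mh = L^{a′}`, `a′ ≥ A₀`,
has (2.60) at `(δ_E, α)` for `toB6 (geo9K i) 1 Hg` (threshold-free: the level gap of the torus family, `B9GeoLemma21KLevelV1.levelGap_geo9K_one`, through
`B9RowSum261DefiniteFaces.ineq260_toB6_of_levelGap`), (2.61) at `(δ_E, 1−α)` with exponent `d′` (`B9Thm37GpTorusRegular.geo_inputs_geo9K`, above its `M`-threshold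
— «for RM satisfying (2.59)»), and the size condition `4·log L ≤ αδ_E·1·(L·L^{a′})`.  Print: «In [4] we have proved all theorems under the assumption that R, M are
sufficiently large. We take these numbers as powers of L».
[cite: Balaban1984PropagatorsII, Lemma 2.1 (2.60)–(2.61) p.234, (2.59) p.233, (2.2) p.224; Balaban1985BackgroundPropagators, p.408 l.30–34, (3.47) p.398] -/
theorem exists_geo_threshold {b₀' b₁' : ℝ} [instF' : ∀ i : KIdx d ℓ hd hL b₀' b₁', Fintype (geo9K i).Site] (hℓ1 : 1 ≤ ℓ)
    {δE α : ℝ} (hδE : 0 < δE) (hα0 : 0 < α) (hα1 : α < 1) (Hg : Prop) :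
    ∃ d' A₀ : ℕ, 8 ≤ (ℓ + 1) ^ A₀ ∧ ∀ a' : ℕ, A₀ ≤ a' → ∀ i : KIdx d ℓ hd hL b₀' b₁', i.Mh = (ℓ + 1) ^ a' →
      Ineq260 (toB6 (geo9K i) 1 Hg) δE α ∧ Ineq261 d' (toB6 (geo9K i) 1 Hg) δE (1 - α) ∧
      4 * Real.log (geo9K i).L ≤ α * δE * 1 * (geo9K i).M := by
  -- (2.61) at `(δ_E, 1−α)` above one `M`-threshold, at the door exponent
  obtain ⟨ML, hML⟩ := B9Thm37GpTorusRegular.geo_inputs_geo9K (d := d) (ℓ := ℓ) (hd := hd) (hL := hL) (b₀ := b₀') (b₁ := b₁')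
    (fun _ => (1 : ℝ)) (fun _ => Hg) (δ₀ := δE) (α := 1 - α) (by nlinarith) hδE.le (by linarith)
  -- the threshold on `a′`
  obtain ⟨A₀, h8, hA₀⟩ := B8Thm2TorusOfProp6DeltaAFour.exists_exponent_ge hℓ1 ⌈max ML (4 * Real.log ((ℓ : ℝ) + 1) / (α * δE))⌉₊
  refine ⟨B9RWSums347DefiniteFaces.exp261 (geo9K (d := d) (ℓ := ℓ) (hd := hd) (hL := hL) (b₀ := b₀') (b₁ := b₁')) δE (1 - α), A₀, h8,
    fun a' ha' i hMh => ?_⟩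
  have hαδ : 0 < α * δE := mul_pos hα0 hδE
  have hL1 : (1 : ℝ) ≤ ((ℓ + 1 : ℕ) : ℝ) := by exact_mod_cast Nat.succ_le_succ (Nat.zero_le ℓ)
  -- `L^{a′} ≥ ⌈max …⌉ ≥ max ML (4 log L ∕ (αδ_E))`
  have hpow : ((⌈max ML (4 * Real.log ((ℓ : ℝ) + 1) / (α * δE))⌉₊ : ℕ) : ℝ) ≤ (((ℓ + 1) ^ a' : ℕ) : ℝ) := by
    exact_mod_cast hA₀.trans (Nat.pow_le_pow_right (Nat.succ_pos ℓ) ha')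
  have hmax : max ML (4 * Real.log ((ℓ : ℝ) + 1) / (α * δE)) ≤ (((ℓ + 1) ^ a' : ℕ) : ℝ) := (Nat.le_ceil _).trans hpow
  -- `M = L·M_h ≥ M_h = L^{a′}`
  have hM : (geo9K i).M = ((ℓ + 1 : ℕ) : ℝ) * (((ℓ + 1) ^ a' : ℕ) : ℝ) := by
    show (((ℓ + 1 : ℕ) : ℝ)) * (i.Mh : ℝ) = _
    rw [hMh]
  have hLa : (((ℓ + 1) ^ a' : ℕ) : ℝ) ≤ (geo9K i).M := by
    rw [hM]; exact le_mul_of_one_le_left (by positivity) hL1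
  refine ⟨B9RowSum261DefiniteFaces.ineq260_toB6_of_levelGap (B9GeoLemma21KLevelV1.levelGap_geo9K_one) hαδ.le Hg i,
    (hML i ((le_max_left _ _).trans (hmax.trans hLa))).2.2.2.1, ?_⟩
  -- the size condition
  have hsz : 4 * Real.log ((ℓ : ℝ) + 1) / (α * δE) ≤ (geo9K i).M := (le_max_right _ _).trans (hmax.trans hLa)
  rw [div_le_iff₀ hαδ] at hsz
  rw [geo9K_L_eq, mul_one]
  linarith

/-- ★★★★★ **THE TORUS THM 2 INTERFACE OF RECORD, EBlock CURRENCY, GEOMETRY DISCHARGED**: for `τ = tr`, `M ≥ 1`, rates `δ_E > 0`, `0 < α < 1`,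
`len`, a basis `b`, transport letters `Rr, Hp, Hg`: THERE ARE an exponent `d′` and a threshold `A₀` such that for every big-block exponent `a′ ≥ A₀` (print's «M
sufficiently large … powers of L», p. 408), every block constant `B_E > 0` (bound AFTER `a′`, so a supplier's `M_h`-dependent constant is admissible) and every `a_T`
in the windows with F7's numeric condition at `B₀ := B_E·c₁(d′, δ_E, 1−α)·L⁴`, §4's conclusion holds with the geometric hypothesis GONE: `∃ a₀′ > 0, ∃ k₀, ∃ c_α > 0, ∀ c_L …, ∃ B₁ B₂ c₁ > 0, ∀ F : T3Family, F.L = ℓ + 1 → ∀ n < K`, [(1) `IsUnit Δ_a` + (E) the (3.42) block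
`EBlock(G_a) B_E δ_E` for every class reading, at the shape-members of the cover torus with `i.Mh = L^{a′}`] → `P ∣ P′ ∧ L^{K−n} ∣ P ∧ Thm2TorusAt (ℓ+1) (K − n) P′
(eta F n K) 0 B₁ B₂ c₁ len SU(2) ⊤`.  HONEST SCOPE: (1), (E) displayed (inhabited by nothing here); `stub_PV3A` NOT discharged; no summit ∕ node statement proved;
nothing continuum ∕ ℝ⁴ ∕ OS — the Yang–Mills mass gap is NOT proved by any of this.
[cite: Balaban1985RegularSpaces, Thm 2 p.83, (1.29) p.81, (1.33)–(1.39) pp.82–83, p.77, (1.58)–(1.60) pp.86–87; Balaban1985BackgroundPropagators, p.408 l.30–34, (3.35)–(3.37) p.396, (3.42) p.397, (3.47) p.398, Thm 3.3 p.399, (3.69) p.404, (3.106) p.414, Thm 3.10 p.416, Thm 3.11 p.416; Balaban1984PropagatorsII, Lemma 2.1 (2.59)–(2.61) pp.233–234; Balaban1985UV3, (1)–(3) p.256] -/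
theorem hThm2Cover_of_prop6_eBlock_exists (hℓ : 4 ≤ ℓ)
    (τ : Matrix (Fin 2) (Fin 2) ℂ →ₗ[ℂ] ℂ) (hτ : ∀ a, τ a = Matrix.trace a) (hτt : ∀ a b, τ (a * b) = τ (b * a))
    {Cτ : ℝ} (hCτ : ∀ x y : Matrix (Fin 2) (Fin 2) ℂ, |(τ (star x * y)).re| ≤ Cτ * ‖x‖ * ‖y‖)
    {M : ℝ} (hM1 : 1 ≤ M) {δE α : ℝ} (hδE : 0 < δE) (hα0 : 0 < α) (hα1 : α < 1)
    {len : LSite (2 + 1) → ℝ}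
    {ι : Type} [Fintype ι] [DecidableEq ι] (b : Module.Basis ι ℝ (Matrix (Fin 2) (Fin 2) ℂ)) {M₂ : ℝ} (hM₂ : 0 ≤ M₂)
    (hrepr : ∀ (v : Matrix (Fin 2) (Fin 2) ℂ) (j : ι), |b.repr v j| ≤ M₂ * ‖v‖) (Rr : ℝ) (Hp Hg : Prop) :
    letI : CStarAlgebra (Matrix (Fin 2) (Fin 2) ℂ) := {}
    ∃ d' A₀ : ℕ, ∀ a' : ℕ, A₀ ≤ a' → ∀ BE : ℝ, 0 < BE →
    ∀ aT : ℝ, 0 < aT → aT ≤ alphaQ (2 + 1) (ℓ + 1) / ((ℓ + 1 : ℕ) : ℝ) ^ 2 → C0 (2 + 1) * aT ≤ 1 / 3 → 2 * aT ≤ c2' (2 + 1) (ℓ + 1) →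
      2 * ((48 * (((2 : ℕ) : ℝ) + 1) + 14 * ((2 : ℕ) : ℝ) * M + (32 * (((2 : ℕ) : ℝ) + 2) ^ 2 +
        12 * (((2 : ℕ) : ℝ) + 1) ^ 2 * (13344 * (((2 : ℕ) : ℝ) + 1) * (((2 : ℕ) : ℝ) + 2) ^ 2 * (((2 : ℕ) : ℝ) + 5) * (((ℓ + 1 : ℕ) : ℝ)) ^ (2 + 4)) *
          (Cτ * betaTau τ))) * aT) * (BE * B6.c1 d' δE (1 - α) * (((ℓ + 1 : ℕ) : ℝ)) ^ 4) ≤ 1 →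
    ∃ a₀' : ℝ, 0 < a₀' ∧ ∃ k₀ : ℕ, ∃ cα : ℝ, 0 < cα ∧
    ∀ cL : ℝ, 0 < cL → cL * (((ℓ + 1 : ℕ) : ℝ)) ^ 2 < a₀' →
      cL ≤ min (1 / 16) (min aT (min aT (1 / (2 * (2 * (BE * B6.c1 d' δE (1 - α) * (((ℓ + 1 : ℕ) : ℝ)) ^ 4)) * (14 * ((2 + 1 - 1 : ℕ) : ℝ)) * M + 1)))) →
      cL ≤ cα →
    ∃ B₁ B₂ c₁ : ℝ, 0 < B₁ ∧ 0 < B₂ ∧ 0 < c₁ ∧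
    ∀ F : T3Family, F.L = ℓ + 1 → ∀ (n K : ℕ), n < K →
      (∀ (i : KIdx 2 ℓ hd₃ hL 1 1) (m' : ℕ), 1 ≤ m' → m' ≤ K - n → i.k = m' + 1 → (∀ x, i.D.lev x = m') → i.Mh = (ℓ + 1) ^ a' →
        i.cf = (((ℓ + 1 : ℕ) : ℝ)) ^ (m' + 1) →
        (∀ ι : IBondY i, i.w ι = i.cf ^ 2 * (((((ℓ + 1 : ℕ) : ℝ)) ^ (ι.1.1 : ℕ)) ^ (2 + 1) * (1 / (((ℓ + 1 : ℕ) : ℝ)) ^ (ι.1.1 : ℕ)) ^ 2)) →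
        (PV 2 ℓ i.m i.K hd₃ hL).sitesPerDir 0 = (PV 2 ℓ (F.m + k₀) K hd₃ hL).sitesPerDir 0 →
        ∀ (α₀ : ℝ) (U₀ : LSite (2 + 1) → Fin (2 + 1) → (Matrix (Fin 2) (Fin 2) ℂ)ˣ),
        (∀ x κ, U₀ x κ ∈ B7Prop2Explicit.unitaryUnits (Matrix (Fin 2) (Fin 2) ℂ)) →
        IsPeriodic ((PV 2 ℓ (F.m + k₀) K hd₃ hL).sitesPerDir 0) U₀ → 0 < α₀ → α₀ ≤ aT →
        InAk (ℓ + 1) m' (eta F n K) α₀ (fun _ => (Set.univ : Set (LSite (2 + 1)))) U₀ →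
          IsUnit (deltaAY i (parKnitY i) (parBY i) (GpY i (parKnitY i)) (bgY i U₀)) ∧
          ∀ (B : B9.Backgrounds) (cfg : B.Cfg → CfgY (Matrix (Fin 2) (Fin 2) ℂ) i) (par : BondParY (Matrix (Fin 2) (Fin 2) ℂ) i) (U₁ : B.Cfg),
            cfg U₁ = bgY i U₀ →
            EBlock (kernelFamilyBInv i B cfg (GAY i (parKnitY i) (parBY i) (GpY i (parKnitY i))) par) BE δE U₁) →
      (((F.P K).sitesPerDir 0 : ℕ) : ℤ) ∣ (((PV 2 ℓ (F.m + k₀) K hd₃ hL).sitesPerDir 0 : ℕ) : ℤ) ∧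
      (((ℓ + 1 : ℕ) : ℤ)) ^ (K - n) ∣ (((F.P K).sitesPerDir 0 : ℕ) : ℤ) ∧
      Thm2TorusAt (ℓ + 1) (K - n) ((((PV 2 ℓ (F.m + k₀) K hd₃ hL).sitesPerDir 0 : ℕ) : ℤ)) (eta F n K) 0 B₁ B₂ c₁ len
        (specialUnitaryUnits (Fin 2)) (fun _ => True) := by
  letI : CStarAlgebra (Matrix (Fin 2) (Fin 2) ℂ) := {}
  obtain ⟨d', A₀, h8, hgeo⟩ := exists_geo_threshold (d := 2) (hd := hd₃) (hL := hL) (b₀' := (1 : ℝ)) (b₁' := (1 : ℝ)) (instF' := instF)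
    (by omega) hδE hα0 hα1 Hg
  refine ⟨d', A₀, fun a' ha' BE hBE aT haT haTQ haT3 haT2 hεB => ?_⟩
  have h8' : 8 ≤ (ℓ + 1) ^ a' := h8.trans (Nat.pow_le_pow_right (Nat.succ_pos ℓ) ha')
  exact hThm2Cover_of_prop6_eBlock (hd₃ := hd₃) (hL := hL) (len := len) hℓ τ hτ hτt hCτ hM1 d' (Rg := 1) (Hg := Hg) hBE hδE hα1 haT haTQ haT3 haT2
    hεB b hM₂ hrepr Rr Hp h8' (hgeo a' ha')

end Cover

end Literature.MathematicalPhysics.QuantumFieldTheory.Balaban1983to89.B8Thm2TorusCoverOfEBlock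

end
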